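import Summits.ResolutionOfSingularities.ResolutionOfSingularities.Theorems.HilbertSamuelEliminationCampaignW42RidgeConeBlowupNonrational
import HarnessLib

/-!
# [OURS · L1 W4.2] Upper semicontinuity of the Hilbert–Samuel function of a cone and of the blow-up of its
# vertex at ALL closed points (any residue field), and "near = equality" (campaign s42, cell res-hironaka;
# informal crux `RidgeConfinement`, stmt-ResolutionOfSingularities-17845; `--supports`)

HONEST FRAMING. OURS (slot W4.2, prover res-L1-s42-pv-1, gen 2): the hypothesis-free half of Hironaka's chain of
`…ConeRidgeClosedPoint.lean` (flat point extension + base-change bound + dictionary + semicontinuity on `C_κ`)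
gives, for a homogeneous ideal `I ⊆ S = K[X_1, …, X_n]` (any field, any characteristic):

* `hilbertSamuelFun_cone_closedPoint_le` — for every maximal ideal `𝔮 ⊇ I` (closed point of the cone `C = V(I)`,
  ANY residue field): **`H⁽ⁿ⁺¹⁾(𝒪_{C,𝔮}) ≤ H(S/I)⁽ⁿ⁺¹⁾`** (the value at the vertex,
  `hilbertFun_localization_vertex_eq_hilbertFunQuot`) — upper semicontinuity along the cone at non-rational points
  (CJS Thm. 2.33 / Rem. 2.29 in this model); hence NEAR (`≥`) is EQUALITY (`iterPSum_le_iff_eq_cone_closedPoint`);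
* `hilbertSamuelFun_blowup_exceptional_closedPoint_le` — for the blow-up of the vertex, chart `j`, strict
  transform `J = I.map (dehomog K j)` and every maximal `𝔮' ⊇ J + (X_j)` (closed point of the exceptional
  divisor): **`H⁽ⁿ⁺¹⁾(𝒪_{Bl_0(C),ξ}) ≤ H(S/I)⁽ⁿ⁺¹⁾ = H⁽ⁿ⁺¹⁾(𝒪_{C,0})`** — CJS Thm. 3.10 (1) for the blow-up of the
  vertex of a cone at all closed points of `E` (`iterPSum_le_iff_eq_exceptional`: near = equality).

Abstract presentations (`π : S ↠ T`, `ρ : T ↠ κ`) as in `…ConeRidgeClosedPoint.lean`, then the self-contained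
forms. NOTHING here is a statement of H. Hironaka's manuscript [Hironaka2017]. AI review is weaker than expert review.
References (orientation only): V. Cossart, U. Jannsen, S. Saito, LNM 2270 (2020), Rem. 2.29, Thm. 2.33,
Thm. 3.10 (1); H. Hironaka, Ann. of Math. 92 (1970).
-/

noncomputable section

-- single-conjunct summit: the doubled namespace component `ResolutionOfSingularities` is mandated
set_option linter.dupNamespace false

open MvPolynomial Module IsLocalRing
open Literature.RingTheory.HilbertSamuel
open Literature.RingTheory.MvPolynomial (shift shift_X)
open Literature.AlgebraicGeometry.Resolution

namespace Summit.ResolutionOfSingularities.ResolutionOfSingularities.Theorems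

namespace CampaignW42

universe u

variable {K : Type u} [Field K] {n : ℕ}

section Abstract

variable {T : Type u} [CommRing T] [IsNoetherianRing T] (π : MvPolynomial (Fin n) K →+* T)
  {κ : Type u} [Field κ] [Algebra K κ] (ρ : T →+* κ)
  {I 𝔮 : Ideal (MvPolynomial (Fin n) K)} (hI : IsHomogeneousIdeal I) [𝔮.IsMaximal]
  (hπ : Function.Surjective π) (hkerπ : RingHom.ker π = I)
  (hρ : Function.Surjective ρ) (hkerρ : RingHom.ker (ρ.comp π) = 𝔮)
  (hρC : ∀ c : K, ρ (π (C c)) = algebraMap K κ c)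
  [(𝔮.map π).IsMaximal]
  [((𝔮.map π).map (C : T →+* MvPolynomial (Fin n) T) ⊔ idealOfVars (Fin n) T).IsMaximal]

include hI hπ hkerπ hρ hkerρ hρC in
/-- **Upper semicontinuity at a closed point of the cone with residue field `κ`**:
`H⁽ⁿ⁺¹⁾(𝒪_{C,𝔮}) ≤ H(S/I)⁽ⁿ⁺¹⁾` (abstract presentations `π : S ↠ T = S/I`, `ρ : T ↠ κ`).
[cite: CossartJannsenSaito2020, Thm. 2.33] -/
theorem hilbertSamuelFun_frame_closedPoint_le :
    hilbertSamuelFun (Localization.AtPrime (𝔮.map π)) (n + 1) ≤ iterPSum (n + 1) (hilbertFunQuot K n I) := by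
  intro m
  set w : Fin n → κ := fun i => ρ (π (X i)) with hw
  have hI' : IsHomogeneousIdeal (coneIdeal κ I) := isHomogeneousIdeal_map (algebraMap K κ) hI
  have hker𝔮 : RingHom.ker π ≤ 𝔮 := fun x hx => by
    rw [← hkerρ, RingHom.mem_ker, RingHom.comp_apply, RingHom.mem_ker.mp hx, map_zero]
  set Nw : ℕ → ℕ := fun d =>
    finrank κ (MvPolynomial (Fin n) κ ⧸ (coneIdeal κ I ⊔ RingHom.ker (eval w) ^ (d + 1))) with hNw
  set N₀ : ℕ → ℕ := fun d =>
    finrank κ (MvPolynomial (Fin n) κ ⧸ (coneIdeal κ I ⊔ idealOfVars (Fin n) κ ^ (d + 1))) with hN₀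
  have hle₁ : Nw ≤ N₀ := fun d => finrank_quotient_sup_ker_eval_pow_le hI' w d
  have hN₀eq : N₀ = psum (hilbertFunQuot K n I) := by
    funext d
    rw [hN₀, ← hilbertFunQuot_map (algebraMap K κ) hI]
    exact finrank_quotient_sup_pow_eq_psum_hilbertFunQuot hI' d
  have h0 : hilbertSamuelFun (Localization.AtPrime (𝔮.map π)) (n + 1) m = hilbertSamuelFun
      (Localization.AtPrime ((𝔮.map π).map (C : T →+* MvPolynomial (Fin n) T) ⊔ idealOfVars (Fin n) T)) 1 m := by
    show iterPSum (n + 1) (hilbertFun _) m = iterPSum 1 (hilbertFun _) m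
    rw [iterPSum_one, hilbertFun_localization_frame_eq (𝔮.map π), hilbertSamuelFun, ← iterPSum_succ]
  have h2 : (hilbertSamuelFun (Localization.AtPrime
      ((𝔮.map π).map (C : T →+* MvPolynomial (Fin n) T) ⊔ idealOfVars (Fin n) T)) 1 m : ℕ∞) ≤
      (iterPSum n Nw m : ℕ) := by
    rw [hilbertSamuelFun_one_eq_length]
    refine (length_quotient_pow_frame_le_sum π 𝔮 _ hπ hker𝔮 m).trans (le_of_eq ?_)
    rw [← sum_iterPSum_Phi_mul_eq n Nw m, Nat.cast_sum]
    refine Finset.sum_congr rfl fun i hi => ?_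
    have hi' : i ≤ m := Nat.lt_succ_iff.mp (Finset.mem_range.mp hi)
    rw [Nat.cast_mul, show m + 1 - i = m - i + 1 by omega,
      length_quotient_frame_eq_finrank π ρ hπ hkerπ hρ hkerρ hρC _ (m - i)]
  have h3 : iterPSum n Nw m ≤ iterPSum (n + 1) (hilbertFunQuot K n I) m := by
    rw [iterPSum_succ', ← hN₀eq]
    exact iterPSum_mono n hle₁ m
  rw [h0]
  exact (show _ ≤ iterPSum n Nw m by exact_mod_cast h2).trans h3

include hI hπ hkerπ hρ hkerρ hρC in
/-- **Near = equality** at a closed point of the cone: `H(S/I)⁽ⁿ⁺¹⁾ ≤ H⁽ⁿ⁺¹⁾(𝒪_{C,𝔮})` iff equality.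
[cite: CossartJannsenSaito2020, Thm. 2.33] -/
theorem iterPSum_le_iff_eq_frame_closedPoint :
    iterPSum (n + 1) (hilbertFunQuot K n I) ≤ hilbertSamuelFun (Localization.AtPrime (𝔮.map π)) (n + 1) ↔
      hilbertSamuelFun (Localization.AtPrime (𝔮.map π)) (n + 1) = iterPSum (n + 1) (hilbertFunQuot K n I) :=
  ⟨fun h => le_antisymm (hilbertSamuelFun_frame_closedPoint_le π ρ hI hπ hkerπ hρ hkerρ hρC) h, fun h => h.ge⟩

end Abstract

/-! ## Self-contained forms -/

/-- **Upper semicontinuity of `H⁽ⁿ⁺¹⁾` along a cone at every closed point** (any residue field):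
`H⁽ⁿ⁺¹⁾((S/I)_𝔮) ≤ H(S/I)⁽ⁿ⁺¹⁾` for every maximal `𝔮 ⊇ I`. [cite: CossartJannsenSaito2020, Thm. 2.33] -/
theorem hilbertSamuelFun_cone_closedPoint_le {I 𝔮 : Ideal (MvPolynomial (Fin n) K)} (hI : IsHomogeneousIdeal I)
    [𝔮.IsMaximal] (hI𝔮 : I ≤ 𝔮) [(𝔮.map (Ideal.Quotient.mk I)).IsMaximal] :
    hilbertSamuelFun (Localization.AtPrime (𝔮.map (Ideal.Quotient.mk I))) (n + 1) ≤
      iterPSum (n + 1) (hilbertFunQuot K n I) := by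
  letI := Ideal.Quotient.field 𝔮
  haveI := isMaximal_map_C_sup_idealOfVars (n := n) (𝔮.map (Ideal.Quotient.mk I))
  refine hilbertSamuelFun_frame_closedPoint_le (Ideal.Quotient.mk I) (κ := MvPolynomial (Fin n) K ⧸ 𝔮)
    (Ideal.Quotient.factor hI𝔮) hI Ideal.Quotient.mk_surjective Ideal.mk_ker
    (Ideal.Quotient.factor_surjective hI𝔮) ?_ (fun c => ?_)
  · rw [Ideal.Quotient.factor_comp_mk, Ideal.mk_ker]
  · rw [Ideal.Quotient.factor_mk]
    rfl

/-- **Near = equality at closed points of the cone.** [cite: CossartJannsenSaito2020, Thm. 2.33] -/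
theorem iterPSum_le_iff_eq_cone_closedPoint {I 𝔮 : Ideal (MvPolynomial (Fin n) K)} (hI : IsHomogeneousIdeal I)
    [𝔮.IsMaximal] (hI𝔮 : I ≤ 𝔮) [(𝔮.map (Ideal.Quotient.mk I)).IsMaximal] :
    iterPSum (n + 1) (hilbertFunQuot K n I) ≤
        hilbertSamuelFun (Localization.AtPrime (𝔮.map (Ideal.Quotient.mk I))) (n + 1) ↔
      hilbertSamuelFun (Localization.AtPrime (𝔮.map (Ideal.Quotient.mk I))) (n + 1) =
        iterPSum (n + 1) (hilbertFunQuot K n I) :=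
  ⟨fun h => le_antisymm (hilbertSamuelFun_cone_closedPoint_le hI hI𝔮) h, fun h => h.ge⟩

/-- **CJS Thm. 3.10 (1) for the blow-up of the vertex of a cone, at every closed point of the exceptional
divisor** (any residue field): `H⁽ⁿ⁺¹⁾((S/J)_{𝔮'}) ≤ H(S/I)⁽ⁿ⁺¹⁾` for the strict transform `J = I.map (dehomog K j)`
and every maximal `𝔮' ⊇ J + (X_j)`. [cite: CossartJannsenSaito2020, Thm. 3.10 (1)] -/
theorem hilbertSamuelFun_blowup_exceptional_closedPoint_le {I : Ideal (MvPolynomial (Fin n) K)}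
    (hI : IsHomogeneousIdeal I) (j : Fin n) {𝔮' : Ideal (MvPolynomial (Fin n) K)} [𝔮'.IsMaximal]
    (hJ𝔮' : I.map (dehomog K j) ≤ 𝔮') (hXj : (X j : MvPolynomial (Fin n) K) ∈ 𝔮')
    [(𝔮'.map (Ideal.Quotient.mk (I.map (dehomog K j)))).IsMaximal] :
    hilbertSamuelFun (Localization.AtPrime (𝔮'.map (Ideal.Quotient.mk (I.map (dehomog K j))))) (n + 1) ≤
      iterPSum (n + 1) (hilbertFunQuot K n I) := by
  -- the twist `Λ` and the cone point `𝔪 = Λ⁻¹(𝔮')`, as in `…RidgeConeBlowupNonrational`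
  let Λ : MvPolynomial (Fin n) K →ₐ[K] MvPolynomial (Fin n) K :=
    (shift (Pi.single j (1 : K))).comp (coordBlowupSubst K (Set.univ : Set (Fin n)) j)
  have hΛj : Λ (X j) = X j + 1 := by
    simp only [Λ, AlgHom.comp_apply, coordBlowupSubst_X_self, shift_X, Pi.single_eq_same, C_1]
  have hΛ : ∀ i, i ≠ j → Λ (X i) = X i * (X j + 1) := fun i hi => by
    have h0 : (Pi.single j (1 : K) : Fin n → K) i = 0 := Pi.single_eq_of_ne hi 1
    simp only [Λ, AlgHom.comp_apply, coordBlowupSubst_X_of_mem_of_ne K Set.univ j (Set.mem_univ i) hi,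
      map_mul, shift_X, Pi.single_eq_same, C_1, h0, C_0, add_zero, mul_comm]
  letI := Ideal.Quotient.field 𝔮'
  -- residue map of `𝔪`: `ρ₀ = mk 𝔮' ∘ Λ`, surjective (as in the non-rational confinement file)
  let ρ₀ : MvPolynomial (Fin n) K →+* MvPolynomial (Fin n) K ⧸ 𝔮' :=
    (Ideal.Quotient.mk 𝔮').comp (Λ : MvPolynomial (Fin n) K →+* MvPolynomial (Fin n) K)
  have hρ₀ : ∀ s, ρ₀ s = Ideal.Quotient.mk 𝔮' (Λ s) := fun s => rfl
  have hmkXj : Ideal.Quotient.mk 𝔮' (X j : MvPolynomial (Fin n) K) = 0 :=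
    Ideal.Quotient.eq_zero_iff_mem.mpr hXj
  have hρ₀surj : Function.Surjective ρ₀ := by
    intro a
    obtain ⟨g, rfl⟩ := Ideal.Quotient.mk_surjective a
    let ev : MvPolynomial (Fin n) K →ₐ[K] MvPolynomial (Fin n) K :=
      aeval fun i => if i = j then (0 : MvPolynomial (Fin n) K) else X i
    refine ⟨ev g, ?_⟩
    have hcomp : ρ₀.comp (ev : MvPolynomial (Fin n) K →+* MvPolynomial (Fin n) K) = Ideal.Quotient.mk 𝔮' := by
      refine MvPolynomial.ringHom_ext (fun c => ?_) (fun i => ?_)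
      · rw [RingHom.comp_apply, RingHom.coe_coe, MvPolynomial.algHom_C, MvPolynomial.algebraMap_eq, hρ₀,
          MvPolynomial.algHom_C, MvPolynomial.algebraMap_eq]
      · rw [RingHom.comp_apply, RingHom.coe_coe, show ev (X i) = if i = j then 0 else X i from aeval_X _ i]
        by_cases hi : i = j
        · subst hi
          rw [if_pos rfl, map_zero, hmkXj]
        · rw [if_neg hi, hρ₀, hΛ i hi, map_mul, map_add, map_one, hmkXj, zero_add, mul_one]
    exact RingHom.congr_fun hcomp g
  have hker : RingHom.ker ρ₀ = 𝔮'.comap (Λ : MvPolynomial (Fin n) K →+* MvPolynomial (Fin n) K) := by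
    ext x
    rw [RingHom.mem_ker, hρ₀, Ideal.mem_comap, RingHom.coe_coe, Ideal.Quotient.eq_zero_iff_mem]
  haveI h𝔪max : (𝔮'.comap (Λ : MvPolynomial (Fin n) K →+* MvPolynomial (Fin n) K)).IsMaximal := by
    rw [← hker]
    exact RingHom.ker_isMaximal_of_surjective ρ₀ hρ₀surj
  have hI𝔪 : I ≤ 𝔮'.comap (Λ : MvPolynomial (Fin n) K →+* MvPolynomial (Fin n) K) :=
    (le_comap_twist_map_dehomog j Λ hΛj hΛ hI).trans (Ideal.comap_mono hJ𝔮')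
  haveI := isMaximal_map_mk_of_le h𝔪max hI𝔪
  have hH := hilbertFun_localization_comap_twist_eq j Λ hΛj hΛ hI hJ𝔮' hXj
  have hle := hilbertSamuelFun_cone_closedPoint_le (n := n) hI hI𝔪
  rw [hilbertSamuelFun, hH] at hle
  exact hle

/-- **Near = equality on the exceptional divisor of `Bl_0(C)`.** [cite: CossartJannsenSaito2020, Thm. 3.10 (1)] -/
theorem iterPSum_le_iff_eq_exceptional {I : Ideal (MvPolynomial (Fin n) K)} (hI : IsHomogeneousIdeal I)
    (j : Fin n) {𝔮' : Ideal (MvPolynomial (Fin n) K)} [𝔮'.IsMaximal] (hJ𝔮' : I.map (dehomog K j) ≤ 𝔮')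
    (hXj : (X j : MvPolynomial (Fin n) K) ∈ 𝔮') [(𝔮'.map (Ideal.Quotient.mk (I.map (dehomog K j)))).IsMaximal] :
    iterPSum (n + 1) (hilbertFunQuot K n I) ≤
        hilbertSamuelFun (Localization.AtPrime (𝔮'.map (Ideal.Quotient.mk (I.map (dehomog K j))))) (n + 1) ↔
      hilbertSamuelFun (Localization.AtPrime (𝔮'.map (Ideal.Quotient.mk (I.map (dehomog K j))))) (n + 1) =
        iterPSum (n + 1) (hilbertFunQuot K n I) :=
  ⟨fun h => le_antisymm (hilbertSamuelFun_blowup_exceptional_closedPoint_le hI j hJ𝔮' hXj) h, fun h => h.ge⟩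

end CampaignW42

end Summit.ResolutionOfSingularities.ResolutionOfSingularities.Theorems
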